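import Summits.NavierStokesRegularity.NavierStokesRegularity.Theses.ExtremiserTransience
import Summits.NavierStokesRegularity.NavierStokesRegularity.Theorems.ExtremiserTransiencePlateauTransferOfSlice
import Summits.NavierStokesRegularity.NavierStokesRegularity.Theorems.ExtremiserTransiencePlateauSliceRigidity
import Summits.NavierStokesRegularity.NavierStokesRegularity.Theorems.ExtremiserTransienceRegularisedSliceTransfer
import HarnessLib

/-!
# Route `ExtremiserTransience`, item `PlateauTransfer` (stmt-NavierStokesRegularity-27677) — closure by its landed split

`PlateauTransfer` (27677) was split (route rev 19) into `PlateauSliceTransfer` (27822) and `PlateauSliceRigidity` (27823) with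
glue `PlateauTransferOfSlice` (27824) = `PlateauSliceTransfer → PlateauSliceRigidity → PlateauTransfer`; all three are landed:
`Theorems.ExtremiserTransience.PlateauSliceTransfer_proof` (ExtremiserTransienceRegularisedSliceTransfer.lean),
`Theses.ExtremiserTransience.plateauSliceRigidity` (ExtremiserTransiencePlateauSliceRigidity.lean) and
`Theses.ExtremiserTransience.plateauTransferOfSlice` (ExtremiserTransiencePlateauTransferOfSlice.lean). This file proves the
parent decl BY NAME by composing them (operator request, ladder-directors bus 21730/21735/21749; gate8 re-opened 27677 because no
Theorems-side theorem concluded the parent decl literally).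

HONEST FRAMING: an implication-chain between statements about hypothetical Type-I singular flows closes vacuously (the one-slice
plateau object is excluded); nothing about Navier–Stokes regularity or blow-up is proved here. [folklore]
-/

set_option autoImplicit false

namespace Summit.NavierStokesRegularity.NavierStokesRegularity.Theses.ExtremiserTransience

/-- **Item 27677 `PlateauTransfer` holds** (the route decl by name): glue 27824 applied to the landed children 27822 and 27823. [folklore] -/
theorem PlateauTransfer_holds :
    Summit.NavierStokesRegularity.NavierStokesRegularity.Theses.ExtremiserTransience.PlateauTransfer :=
  Summit.NavierStokesRegularity.NavierStokesRegularity.Theses.ExtremiserTransience.plateauTransferOfSlice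
    Summit.NavierStokesRegularity.NavierStokesRegularity.Theorems.ExtremiserTransience.PlateauSliceTransfer_proof
    Summit.NavierStokesRegularity.NavierStokesRegularity.Theses.ExtremiserTransience.plateauSliceRigidity

end Summit.NavierStokesRegularity.NavierStokesRegularity.Theses.ExtremiserTransience
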